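import Summits.HubbardSuperconductivity.HubbardSuperconductivity.Theorems.WcbcsSsbToTorusLRO.Negative.SummitMatrixUniformFloor
import Summits.HubbardSuperconductivity.HubbardSuperconductivity.Theses.AposterioriCapRg
import HarnessLib

/-!
# Route `AposterioriCapRg` — crux `SsbToEvenTorusLro` (stmt-HubbardSuperconductivity-1315),
# line `floating-mu-two-sided-pair-transfer`: the SEED residue is NECESSARY

The line's order input `stub_sourcedBrightSeed` (SEED: under the crux antecedents, ONE bright low-excess
normalised vector in some even sector within `L^{1-ε}` of `N_L`, for all large even `L`) is implied by the
crux's own conclusion: by the landed uniform-floor normal form of the summit matrix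
(`WcbcsSsbToTorusLRO.Negative.floor_of_hasDWavePairFieldLROAt`) every normalised ground state of the
summit's sector `(N_L, S^z = 0)` is bright, eventually along even sides, and a ground state has excess `0`;
so the seed may be taken IN the sector `N_L` itself (`m = N_L`, `ε = 1/2`, `E₁ = 0`). Hence, of the three
open residues of the line (SEED, RIGIDITY, CONVEXITY), SEED is crux-necessary, and the every-ground-state
content of the crux sits in RIGIDITY ∧ CONVEXITY (the sector-hopping mechanism). Pure bookkeeping over landed
lemmas; no definition and no named fact is introduced. Source for the tower-of-states picture: T. Koma,
H. Tasaki, J. Stat. Phys. 76 (1994) 745, §2; the statements are folklore.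
-/

noncomputable section

namespace Summit.HubbardSuperconductivity.HubbardSuperconductivity.Theorems

-- summit = problem name (single-conjunct summit), D-0017
set_option linter.dupNamespace false

open Literature.MathematicalPhysics.QuantumLattice Literature.Probability.LatticeModels
open Literature.Barriers.HubbardSuperconductivity (HasDWavePairFieldLROAt)
open Filter Set Matrix
open scoped ComplexOrder ComplexConjugate
open Summit.HubbardSuperconductivity.HubbardSuperconductivity.Theses.AposterioriCapRg (SsbToEvenTorusLro)

/-- **The summit matrix at `(U, δ)` supplies the SEED** (pointwise form): if every admissible sequence has
`d`-wave pair LRO then, for all large even `L`, the sector `N_L` itself contains a normalised ground state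
(excess `0 ≤ 0/L`) with pair order `≥ bL⁴` — a seed with `m = N_L`, `ε = 1/2`, `E₁ = 0`. [folklore] -/
theorem sourcedBrightSeed_of_hasDWavePairFieldLROAt {U δ : ℝ} (hδ : 0 ≤ δ) (h : HasDWavePairFieldLROAt U δ) :
    ∃ b ε E₁ : ℝ, 0 < b ∧ ε ∈ Set.Ioo (0:ℝ) 1 ∧ ∃ L₀ : ℕ, ∀ (L : ℕ) [NeZero L], L₀ ≤ L → Even L → ∃ (m : ℕ) (φ : Fock (Orb (FermionTorus 2 L))), Even m ∧ |(m : ℝ) - ((2 * ⌊(1 - δ) * (L : ℝ) ^ 2 / 2⌋₊ : ℕ) : ℝ)| ≤ (L : ℝ) ^ (1 - ε) ∧ φ ∈ szSector m 0 ∧ star φ ⬝ᵥ φ = 1 ∧ (expect (hubbardTorus 2 L 1 U) φ).re ≤ (hubbardTorus 2 L 1 U).minEnergyOn (szSector m 0) + E₁ / (L : ℝ) ∧ b * (L : ℝ) ^ 4 ≤ (expect ((pairField dWaveFormFactor L)ᴴ * pairField dWaveFormFactor L) φ).re := by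
  obtain ⟨a, ha, hev⟩ := WcbcsSsbToTorusLRO.Negative.floor_of_hasDWavePairFieldLROAt hδ h
  obtain ⟨K₀, hK₀⟩ := eventually_atTop.1 hev
  refine ⟨a, 1 / 2, 0, ha, ⟨by norm_num, by norm_num⟩, 2 * K₀ + 1 + 1, ?_⟩
  intro L _ hL hLe
  -- `L = 2k + 2` with `k ≥ K₀`
  obtain ⟨k, rfl⟩ : ∃ k, L = 2 * k + 1 + 1 := by
    obtain ⟨r, hr⟩ := hLe
    exact ⟨r - 1, by omega⟩
  have hk : K₀ ≤ k := by omega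
  -- a normalised ground state of the summit's sector
  obtain ⟨φ, hφ1, hφ⟩ := WcbcsSsbToTorusLRO.Negative.exists_unit_groundStateInSector (2 * k + 1 + 1) U
    (n := ⌊(1 - δ) * (((2 * k + 1 + 1 : ℕ)) : ℝ) ^ 2 / 2⌋₊)
    (WcbcsSsbToTorusLRO.Negative.halfFilling_floor_le_sq (2 * k + 1 + 1) hδ)
  refine ⟨2 * ⌊(1 - δ) * (((2 * k + 1 + 1 : ℕ)) : ℝ) ^ 2 / 2⌋₊, φ, ⟨_, (two_mul _)⟩, ?_, hφ.1, hφ1, ?_,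
    hK₀ k hk φ hφ hφ1⟩
  · rw [sub_self, abs_zero]; positivity
  · rw [zero_div, add_zero]
    have : expect (hubbardTorus 2 (2 * k + 1 + 1) 1 U) φ =
        (((hubbardTorus 2 (2 * k + 1 + 1) 1 U).minEnergyOn
          (szSector (2 * ⌊(1 - δ) * (((2 * k + 1 + 1 : ℕ)) : ℝ) ^ 2 / 2⌋₊) 0) : ℝ) : ℂ) := by
      rw [expect, hφ.2.2, dotProduct_smul, hφ1, smul_eq_mul, mul_one]
    rw [this, Complex.ofReal_re]

/-- **SEED is crux-necessary**: the crux implies the consequent of `stub_sourcedBrightSeed` under its own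
antecedents (indeed from the conclusion at `(U, δ)` alone). [folklore] -/
theorem sourcedBrightSeed_of_crux :
    SsbToEvenTorusLro → ∀ (U δ μ : ℝ), 0 < U → δ ∈ Set.Ioo (0:ℝ) 1 → Filter.Tendsto (fun L : ℕ => ((hubbardTorusWith 2 (L + 1) 1 U μ).groundStateFunctional totalNumber).re / ((L + 1 : ℕ) : ℝ) ^ 2) Filter.atTop (nhds (1 - δ)) → HasDWaveOrder U μ → ∃ b ε E₁ : ℝ, 0 < b ∧ ε ∈ Set.Ioo (0:ℝ) 1 ∧ ∃ L₀ : ℕ, ∀ (L : ℕ) [NeZero L], L₀ ≤ L → Even L → ∃ (m : ℕ) (φ : Fock (Orb (FermionTorus 2 L))), Even m ∧ |(m : ℝ) - ((2 * ⌊(1 - δ) * (L : ℝ) ^ 2 / 2⌋₊ : ℕ) : ℝ)| ≤ (L : ℝ) ^ (1 - ε) ∧ φ ∈ szSector m 0 ∧ star φ ⬝ᵥ φ = 1 ∧ (expect (hubbardTorus 2 L 1 U) φ).re ≤ (hubbardTorus 2 L 1 U).minEnergyOn (szSector m 0) + E₁ / (L : ℝ) ∧ b * (L : ℝ) ^ 4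 ≤ (expect ((pairField dWaveFormFactor L)ᴴ * pairField dWaveFormFactor L) φ).re :=
  fun h U δ μ hU hδ hD hO => sourcedBrightSeed_of_hasDWavePairFieldLROAt hδ.1.le (h U δ μ hU hδ hD hO)

end Summit.HubbardSuperconductivity.HubbardSuperconductivity.Theorems

end
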